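import Literature.Combinatorics.Sahi2008.Multilinear
import Literature.Combinatorics.Sahi2008.UniformSquareAllOrders
import Mathlib.Data.Finset.Sort
import HarnessLib

/-!
# `NoHeavyLowerTail` (crux stmt-CriticalPhenomena-4575), Sahi programme: **THE PRODUCT FORMULA FOR SPLIT FAMILIES —
# if the slots of a family `H` fall into two groups with vanishing mixed moments across the groups, then
# `E_n(H) = −E_p(H|group 1) · E_q(H|group 2)`** (every order, any real weight), plus the multilinear subset expansion

Support file (Sahi cell, seat `prim-sahi-p1`, generation 52; `--supports stmt-CriticalPhenomena-4575`); part 1 of 2 (part 2: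
`…SahiTangentLayerLaw` — the law of total `E_n` on `Bool × α` in the `(E¹,E⁰)` basis and the additivity of `E_n` in the weight).
Pure proofs, NO definitions, no `sorry`, standard axioms.  Vocabulary: `sahiE`, `ex` of `Literature/Combinatorics/Sahi2008`.

THE MATHEMATICS.
* §1 `sahiE_add_eq_sum_subsets` — MULTILINEAR EXPANSION: `E_n(G + H) = Σ_{S ⊆ [n]} E_n(H on S, G off S)` (induction on the set
  of expanded slots with `sahiE_update_add`).
* §3 `sahiE_eq_neg_mul_of_cross_moments` — **PRODUCT FORMULA**: for ANY real weight `w` on a finite type and a family `H` of `n+2`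
  functions whose slots are split into two nonempty disjoint covering groups, enumerated increasingly by `e₁ : Fin p → [n+2]`,
  `e₂ : Fin q → [n+2]`, such that EVERY MIXED MOMENT ACROSS THE GROUPS VANISHES (`E_w(Π_{i∈T} H_i) = 0` whenever `T` meets both
  groups — e.g. the two groups are supported on disjoint parts of the space, such as the two layers of `Bool × α`):
  `E_{n+2}(H) = −E_p(H∘e₁) · E_q(H∘e₂)`.  At `n+2 = 2` this is `Cov(f,g) = −E f·E g` for `E(fg) = 0`; the inequality shadow
  "a nonnegative slot disjoint from the product of the others makes `E_n ≤ 0`" is gen 47's `sahiE_nonpos_of_prod_eq_zero`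
  (`…SahiTangentDisjointSlot`).  MECHANISM: `1 − G_w(F)` [Sahi2008, eq. (3)/(14)] is a product over the points of the space, so it
  factorises over a disjoint decomposition; here proved for the tree's recursive `sahiE` WITHOUT series: peel a slot of group 1 by the
  Lieb–Sahi recursion [LiebSahi2021, Prop. 3.3] — a group-2 slot absorbing it acquires identically vanishing moments
  (`sahiE_update_eq_zero_of_moments`, so its summand is `0`), the group-1 slots reproduce the recursion of `E_p(H∘e₁)`, and the factor
  `E_q(H∘e₂)` rides along (`…_head`: group 1 = the head alone; `…_step`: the induction step; then induction on `n` with the head in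
  either group).
Exact pre-check outside Lean (seat `code/gen52/verify_layers.py`, Fractions, random signed rational weights/functions, `n ≤ 6`):
0 mismatches.  PLACEMENT (added after landing): = the two-block case of the cell's law of total cumulance `SahiTotalCumulance.sahiE_prod_eq_sum_partition`
(prim-masterthm P4), here under the bare hypothesis "mixed moments vanish".  Nothing conjectural is asserted. [this work; mechanism: Sahi2008 eq. (3)/(14)]
-/

namespace Summit.CriticalPhenomena.PercolationContinuityZ3.Theorems.SahiTangent

open Finset Function Literature.Combinatorics.Sahi2008
open scoped BigOperators

noncomputable section

variable {α : Type*} [Fintype α]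

/-! ### §1 Multilinear expansion over subsets of slots -/

/-- **Multilinear expansion of a slotwise sum**: `E_n(G_0+H_0,…,G_{n−1}+H_{n−1}) = Σ_{S ⊆ [n]} E_n(F^S)`, `F^S_l = H_l` for `l ∈ S`,
`G_l` otherwise (induction on the set of expanded slots, additivity of `E_n` in each slot). [cite: Sahi2008, p. 211 (multilinearity)] -/
theorem sahiE_add_eq_sum_subsets (μ : α → ℝ) {n : ℕ} (G H : Fin n → α → ℝ) :
    sahiE μ n (fun l => G l + H l) = ∑ S : Finset (Fin n), sahiE μ n (fun l => if l ∈ S then H l else G l) := by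
  classical
  -- partial expansion over the slots of `T`
  have key : ∀ (T : Finset (Fin n)) (G : Fin n → α → ℝ),
      sahiE μ n (fun l => if l ∈ T then G l + H l else G l)
        = ∑ S ∈ T.powerset, sahiE μ n (fun l => if l ∈ S then H l else G l) := by
    intro T
    induction T using Finset.induction_on with
    | empty =>
      intro G
      simp only [Finset.notMem_empty, if_false, Finset.powerset_empty, Finset.sum_singleton]
    | @insert a T haT ih =>
      intro G
      have hsplit : (fun l => if l ∈ insert a T then G l + H l else G l)
          = update (fun l => if l ∈ T then G l + H l else G l) a (G a + H a) := by
        funext l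
        by_cases hla : l = a
        · subst hla; simp [haT]
        · rw [update_of_ne hla]; simp [Finset.mem_insert, hla]
      have hG : update (fun l => if l ∈ T then G l + H l else G l) a (G a)
          = fun l => if l ∈ T then G l + H l else G l := by
        funext l
        by_cases hla : l = a
        · subst hla; simp [haT]
        · rw [update_of_ne hla]
      have hH : update (fun l => if l ∈ T then G l + H l else G l) a (H a)
          = fun l => if l ∈ T then (update G a (H a)) l + H l else (update G a (H a)) l := by
        funext l
        by_cases hla : l = a
        · subst hla; simp [haT]
        · rw [update_of_ne hla, update_of_ne hla]
      rw [hsplit, sahiE_update_add, hG, hH, ih G, ih (update G a (H a)), Finset.sum_powerset_insert haT]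
      congr 1
      refine Finset.sum_congr rfl fun S hS => ?_
      have haS : a ∉ S := fun h => haT (Finset.mem_powerset.1 hS h)
      congr 1
      funext l
      by_cases hla : l = a
      · subst hla; simp [haS]
      · rw [update_of_ne hla]; simp [Finset.mem_insert, hla]
  have h := key univ G
  simp only [Finset.mem_univ, if_true] at h
  rw [h, Finset.powerset_univ]

/-! ### §2 Bookkeeping: slots with vanishing moments, strictly increasing enumerations -/

variable {β : Type*} [Fintype β]

/-- A slot all of whose mixed moments with the other slots vanish kills `E_n`. [folklore] -/
theorem sahiE_update_eq_zero_of_moments (w : β → ℝ) {n : ℕ} (f : Fin n → β → ℝ) (k : Fin n) (u : β → ℝ)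
    (h : ∀ S : Finset (Fin n), k ∉ S → ex w (u * ∏ i ∈ S, f i) = 0) :
    sahiE w n (update f k u) = 0 := by
  rw [sahiE_update_congr_of_moments w f k (v := 0) (fun S hS => by rw [h S hS, zero_mul, ex, ]; simp),
    sahiE_update_zero]

/-- A strictly increasing map `Fin q → Fin m` that is onto is the identity (so `q = m` and `E_q(G∘e) = E_m(G)`). [folklore] -/
theorem sahiE_comp_eq_of_strictMono_surjective (w : β → ℝ) {q m : ℕ} (G : Fin m → β → ℝ) (e : Fin q → Fin m)
    (he : StrictMono e) (hsurj : Function.Surjective e) :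
    sahiE w q (fun r => G (e r)) = sahiE w m G := by
  have hbij : Function.Bijective e := ⟨he.injective, hsurj⟩
  have hqm : q = m := by simpa using Fintype.card_of_bijective hbij
  subst hqm
  have hid : e = id := (he.range_inj strictMono_id).1 (by
    rw [Set.range_id]; exact Set.range_eq_univ.mpr hsurj)
  subst hid
  rfl

/-- Moments of a tail slot multiplied by the head: `E((f_{i+1}·f_0)·Π_{j∈S} f_{j+1}) = E(Π_{T} f)` with
`T = {0} ∪ succ(insert i S)`. [folklore] -/
theorem ex_tail_mul_head_prod (w : β → ℝ) {n : ℕ} (f : Fin (n + 2) → β → ℝ) (i : Fin (n + 1))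
    (S : Finset (Fin (n + 1))) (hi : i ∉ S) :
    ex w (Fin.tail f i * f 0 * ∏ j ∈ S, Fin.tail f j)
      = ex w (∏ j ∈ insert (0 : Fin (n + 2)) ((insert i S).map (Fin.succEmb (n + 1))), f j) := by
  have h0 : (0 : Fin (n + 2)) ∉ (insert i S).map (Fin.succEmb (n + 1)) := by
    simp only [Finset.mem_map, Fin.coe_succEmb, not_exists, not_and]
    exact fun j _ => Fin.succ_ne_zero j
  rw [Finset.prod_insert h0, Finset.prod_map, Finset.prod_insert hi]
  congr 1
  funext x
  simp only [Pi.mul_apply, Finset.prod_apply, Fin.coe_succEmb, Fin.tail]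
  ring

/-! ### §3 The product formula for families split across two disjointly supported groups -/

/-- **Product formula, base case** (group 1 = the head slot alone): if every moment containing the head slot and a slot
of the group enumerated by `e₂` vanishes, and `e₂` enumerates all the other slots, then
`E_{n+2}(H) = −E(H_0)·E_q(H∘e₂)`. [this work] -/
theorem sahiE_eq_neg_mul_of_cross_moments_head (w : β → ℝ) {n q : ℕ} (H : Fin (n + 2) → β → ℝ)
    (e₂ : Fin q → Fin (n + 2)) (he₂ : StrictMono e₂) (hne : ∀ r, e₂ r ≠ 0)
    (hcover : ∀ i : Fin (n + 2), i ≠ 0 → ∃ r, e₂ r = i)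
    (hcross : ∀ T : Finset (Fin (n + 2)), (0 : Fin (n + 2)) ∈ T → (∃ r, e₂ r ∈ T) → ex w (∏ i ∈ T, H i) = 0) :
    sahiE w (n + 2) H = -(ex w (H 0) * sahiE w q (fun r => H (e₂ r))) := by
  classical
  rw [sahiE_succ_succ]
  -- every summand vanishes: the slot `i` of the tail absorbing `H 0` has identically vanishing moments
  have hsum : ∀ i : Fin (n + 1), sahiE w (n + 1) (update (Fin.tail H) i (Fin.tail H i * H 0)) = 0 := by
    intro i
    refine sahiE_update_eq_zero_of_moments w (Fin.tail H) i _ fun S hS => ?_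
    rw [ex_tail_mul_head_prod w H i S hS]
    obtain ⟨r, hr⟩ := hcover i.succ (Fin.succ_ne_zero i)
    refine hcross _ (Finset.mem_insert_self _ _) ⟨r, ?_⟩
    rw [hr]
    refine Finset.mem_insert_of_mem (Finset.mem_map.2 ⟨i, Finset.mem_insert_self _ _, rfl⟩)
  -- the tail is the group-2 family
  set e₂' : Fin q → Fin (n + 1) := fun r => (e₂ r).pred (hne r) with he₂'_def
  have hsucc : ∀ r, (e₂' r).succ = e₂ r := fun r => Fin.succ_pred (e₂ r) (hne r)
  have he₂' : StrictMono e₂' := by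
    intro a b hab
    have h := he₂ hab
    rw [← hsucc a, ← hsucc b] at h
    exact Fin.succ_lt_succ_iff.1 h
  have hsurj : Function.Surjective e₂' := by
    intro i
    obtain ⟨r, hr⟩ := hcover i.succ (Fin.succ_ne_zero i)
    refine ⟨r, Fin.succ_injective _ ?_⟩
    rw [hsucc, hr]
  have htail : sahiE w (n + 1) (Fin.tail H) = sahiE w q (fun r => H (e₂ r)) := by
    rw [← sahiE_comp_eq_of_strictMono_surjective w (Fin.tail H) e₂' he₂' hsurj]
    congr 1
    funext r
    simp only [Fin.tail, hsucc]
  simp only [hsum, Finset.sum_const_zero, zero_sub, htail]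
  ring

/-- **Product formula, induction step** (head slot in group 1, group 1 has at least two slots): granted the product
formula for the tail families split along `e₁'`, `e₂'` (the enumerations of the two groups shifted down by one), it holds
for `H` split along `e₁`, `e₂`. [this work] -/
theorem sahiE_eq_neg_mul_of_cross_moments_step (w : β → ℝ) {n p q : ℕ} (H : Fin (n + 2) → β → ℝ)
    (e₁ : Fin (p + 2) → Fin (n + 2)) (e₂ : Fin q → Fin (n + 2))
    (e₁' : Fin (p + 1) → Fin (n + 1)) (e₂' : Fin q → Fin (n + 1))
    (h0 : e₁ 0 = 0) (he₁' : ∀ r, e₁ r.succ = (e₁' r).succ) (he₂' : ∀ r, e₂ r = (e₂' r).succ)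
    (hinj : Function.Injective e₁') (hdisj : ∀ r r', e₁' r ≠ e₂' r')
    (hcover : ∀ i : Fin (n + 1), (∃ r, e₁' r = i) ∨ (∃ r, e₂' r = i))
    (hcross : ∀ T : Finset (Fin (n + 2)), (∃ r, e₁ r ∈ T) → (∃ r, e₂ r ∈ T) → ex w (∏ i ∈ T, H i) = 0)
    (IH : ∀ G : Fin (n + 1) → β → ℝ,
      (∀ T : Finset (Fin (n + 1)), (∃ r, e₁' r ∈ T) → (∃ r, e₂' r ∈ T) → ex w (∏ i ∈ T, G i) = 0) →
        sahiE w (n + 1) G = -(sahiE w (p + 1) (fun r => G (e₁' r)) * sahiE w q (fun r => G (e₂' r)))) :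
    sahiE w (n + 2) H = -(sahiE w (p + 2) (fun r => H (e₁ r)) * sahiE w q (fun r => H (e₂ r))) := by
  classical
  -- cross moments of tail families
  have hcrossT : ∀ T : Finset (Fin (n + 1)), (∃ r, e₁' r ∈ T) → (∃ r, e₂' r ∈ T) →
      ex w (∏ i ∈ T, Fin.tail H i) = 0 := by
    rintro T ⟨r₁, hr₁⟩ ⟨r₂, hr₂⟩
    have : ∏ i ∈ T, Fin.tail H i = ∏ j ∈ T.map (Fin.succEmb (n + 1)), H j := by
      rw [Finset.prod_map]; rfl
    rw [this]
    refine hcross _ ⟨r₁.succ, ?_⟩ ⟨r₂, ?_⟩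
    · rw [he₁']; exact Finset.mem_map.2 ⟨_, hr₁, rfl⟩
    · rw [he₂']; exact Finset.mem_map.2 ⟨_, hr₂, rfl⟩
  have hcrossU : ∀ (i : Fin (n + 1)) (T : Finset (Fin (n + 1))), (∃ r, e₁' r ∈ T) → (∃ r, e₂' r ∈ T) →
      ex w (∏ j ∈ T, update (Fin.tail H) i (Fin.tail H i * H 0) j) = 0 := by
    rintro i T ⟨r₁, hr₁⟩ ⟨r₂, hr₂⟩
    by_cases hi : i ∈ T
    · rw [Finset.prod_update_of_mem hi, Finset.sdiff_singleton_eq_erase]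
      have hiT : i ∉ T.erase i := Finset.notMem_erase i T
      rw [ex_tail_mul_head_prod w H i (T.erase i) hiT, Finset.insert_erase hi]
      refine hcross _ ⟨0, by rw [h0]; exact Finset.mem_insert_self _ _⟩ ⟨r₂, ?_⟩
      rw [he₂']
      exact Finset.mem_insert_of_mem (Finset.mem_map.2 ⟨_, hr₂, rfl⟩)
    · rw [Finset.prod_update_of_notMem hi]
      exact hcrossT T ⟨r₁, hr₁⟩ ⟨r₂, hr₂⟩
  -- summands of group 2 vanish
  have hzero : ∀ r', sahiE w (n + 1) (update (Fin.tail H) (e₂' r') (Fin.tail H (e₂' r') * H 0)) = 0 := by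
    intro r'
    refine sahiE_update_eq_zero_of_moments w (Fin.tail H) (e₂' r') _ fun S hS => ?_
    rw [ex_tail_mul_head_prod w H (e₂' r') S hS]
    refine hcross _ ⟨0, by rw [h0]; exact Finset.mem_insert_self _ _⟩ ⟨r', ?_⟩
    rw [he₂']
    exact Finset.mem_insert_of_mem (Finset.mem_map.2 ⟨_, Finset.mem_insert_self _ _, rfl⟩)
  -- summands of group 1: induction hypothesis
  have hone : ∀ r, sahiE w (n + 1) (update (Fin.tail H) (e₁' r) (Fin.tail H (e₁' r) * H 0))
      = -(sahiE w (p + 1) (update (fun r => H (e₁ r.succ)) r (H (e₁ r.succ) * H 0))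
          * sahiE w q (fun r => H (e₂ r))) := by
    intro r
    rw [IH _ (hcrossU (e₁' r))]
    congr 2
    · congr 1
      funext r''
      by_cases hr : r'' = r
      · subst hr; simp only [update_self, Fin.tail, he₁']
      · rw [update_of_ne hr, update_of_ne (fun h => hr (hinj h))]
        simp only [Fin.tail, he₁']
    · congr 1
      funext r''
      rw [update_of_ne (fun h => hdisj r r'' h.symm)]
      simp only [Fin.tail, he₂']
  -- the tail itself
  have htail : sahiE w (n + 1) (Fin.tail H)
      = -(sahiE w (p + 1) (fun r => H (e₁ r.succ)) * sahiE w q (fun r => H (e₂ r))) := by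
    rw [IH _ hcrossT]
    congr 2
    · congr 1; funext r; simp only [Fin.tail, he₁']
    · congr 1; funext r; simp only [Fin.tail, he₂']
  -- reorganise the sum over the slots of the tail: only group-1 slots contribute
  have hsum : ∑ i : Fin (n + 1), sahiE w (n + 1) (update (Fin.tail H) i (Fin.tail H i * H 0))
      = ∑ r : Fin (p + 1), sahiE w (n + 1) (update (Fin.tail H) (e₁' r) (Fin.tail H (e₁' r) * H 0)) := by
    symm
    refine Finset.sum_of_injOn e₁' (fun a _ b _ h => hinj h) (fun r _ => Finset.mem_univ _)
      (fun i _ hi => ?_) (fun r _ => rfl)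
    rcases hcover i with ⟨r, hr⟩ | ⟨r, hr⟩
    · exact (hi ⟨r, Finset.mem_coe.2 (Finset.mem_univ r), hr⟩).elim
    · rw [← hr]; exact hzero r
  -- the recursion for the group-1 family
  have hrec : sahiE w (p + 2) (fun r => H (e₁ r))
      = (∑ r : Fin (p + 1), sahiE w (p + 1) (update (fun r => H (e₁ r.succ)) r (H (e₁ r.succ) * H 0)))
        - sahiE w (p + 1) (fun r => H (e₁ r.succ)) * ex w (H 0) := by
    rw [sahiE_succ_succ, h0]
    rfl
  rw [sahiE_succ_succ, hsum, htail, hrec]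
  simp only [hone]
  rw [Finset.sum_neg_distrib, ← Finset.sum_mul]
  ring

/-- **The product formula for families split across two disjointly supported groups.**  Let `w` be ANY real weight on a
finite type, `H` a family of `n + 2` functions, and `e₁ : Fin p → [n+2]`, `e₂ : Fin q → [n+2]` strictly increasing
enumerations of two nonempty, disjoint, covering groups of slots such that every mixed moment across the groups vanishes:
`E_w(Π_{i∈T} H_i) = 0` whenever `T` meets both groups.  Then
`E_{n+2}(H) = −E_p(H∘e₁) · E_q(H∘e₂)`.
(`n + 2 = 2`: `Cov(f,g) = −E f·E g` when `E(fg) = 0`.) [this work] -/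
theorem sahiE_eq_neg_mul_of_cross_moments (w : β → ℝ) :
    ∀ (n p q : ℕ) (H : Fin (n + 2) → β → ℝ) (e₁ : Fin p → Fin (n + 2)) (e₂ : Fin q → Fin (n + 2)),
      StrictMono e₁ → StrictMono e₂ → 0 < p → 0 < q → (∀ r r', e₁ r ≠ e₂ r') →
      (∀ i : Fin (n + 2), (∃ r, e₁ r = i) ∨ (∃ r, e₂ r = i)) →
      (∀ T : Finset (Fin (n + 2)), (∃ r, e₁ r ∈ T) → (∃ r, e₂ r ∈ T) → ex w (∏ i ∈ T, H i) = 0) →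
      sahiE w (n + 2) H = -(sahiE w p (fun r => H (e₁ r)) * sahiE w q (fun r => H (e₂ r))) := by
  classical
  -- the statement with the head slot in group 1, by induction on `n`
  have main : ∀ (n p q : ℕ) (H : Fin (n + 2) → β → ℝ) (e₁ : Fin (p + 1) → Fin (n + 2)) (e₂ : Fin q → Fin (n + 2)),
      StrictMono e₁ → StrictMono e₂ → e₁ 0 = 0 → 0 < q → (∀ r r', e₁ r ≠ e₂ r') →
      (∀ i : Fin (n + 2), (∃ r, e₁ r = i) ∨ (∃ r, e₂ r = i)) →
      (∀ T : Finset (Fin (n + 2)), (∃ r, e₁ r ∈ T) → (∃ r, e₂ r ∈ T) → ex w (∏ i ∈ T, H i) = 0) →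
      sahiE w (n + 2) H = -(sahiE w (p + 1) (fun r => H (e₁ r)) * sahiE w q (fun r => H (e₂ r))) := by
    intro n
    induction n with
    | zero =>
      intro p q H e₁ e₂ he₁ he₂ h0 hq hdisj hcover hcross
      -- in `Fin 2`, group 1 is the head alone
      obtain ⟨q', rfl⟩ : ∃ q', q = q' + 1 := Nat.exists_eq_add_one.2 hq
      have hp : p = 0 := by
        rcases Nat.eq_zero_or_pos p with hp | hp
        · exact hp
        · exfalso
          have h1 : e₁ ⟨1, by omega⟩ = 1 := by
            have hlt : e₁ 0 < e₁ ⟨1, by omega⟩ := he₁ (Fin.mk_lt_mk.2 Nat.zero_lt_one)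
            rw [h0] at hlt
            exact Fin.eq_one_of_ne_zero _ (ne_of_gt hlt)
          have hne0 : e₂ 0 ≠ 0 := fun h => hdisj 0 0 (h0.trans h.symm)
          exact hdisj ⟨1, by omega⟩ 0 (h1.trans (Fin.eq_one_of_ne_zero _ hne0).symm)
      subst hp
      have hne : ∀ r, e₂ r ≠ 0 := fun r h => hdisj 0 r (h0.trans h.symm)
      have hcover' : ∀ i : Fin 2, i ≠ 0 → ∃ r, e₂ r = i := by
        intro i hi
        rcases hcover i with ⟨r, hr⟩ | h
        · exact (hi (by rw [← hr, Fin.eq_zero r, h0])).elim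
        · exact h
      rw [sahiE_eq_neg_mul_of_cross_moments_head w H e₂ he₂ hne hcover'
        (fun T hT h2 => hcross T ⟨0, by rwa [h0]⟩ h2), sahiE_one_apply, h0]
    | succ n ih =>
      intro p q H e₁ e₂ he₁ he₂ h0 hq hdisj hcover hcross
      have hne : ∀ r, e₂ r ≠ 0 := fun r h => hdisj 0 r (h0.trans h.symm)
      rcases Nat.eq_zero_or_pos p with hp | hp
      · -- group 1 = head alone
        subst hp
        have hcover' : ∀ i : Fin (n + 1 + 2), i ≠ 0 → ∃ r, e₂ r = i := by
          intro i hi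
          rcases hcover i with ⟨r, hr⟩ | h
          · exact (hi (by rw [← hr, Fin.eq_zero r, h0])).elim
          · exact h
        rw [sahiE_eq_neg_mul_of_cross_moments_head w H e₂ he₂ hne hcover'
          (fun T hT h2 => hcross T ⟨0, by rwa [h0]⟩ h2), sahiE_one_apply, h0]
      · -- group 1 has ≥ 2 slots: peel the head and use the induction hypothesis
        obtain ⟨p', rfl⟩ : ∃ p', p = p' + 1 := Nat.exists_eq_add_one.2 hp
        have hne₁ : ∀ r : Fin (p' + 1), e₁ r.succ ≠ 0 := by
          intro r h
          have hlt : e₁ 0 < e₁ r.succ := he₁ (Fin.succ_pos r)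
          rw [h] at hlt
          exact (Fin.not_lt_zero _ hlt).elim
        set e₁' : Fin (p' + 1) → Fin (n + 2) := fun r => (e₁ r.succ).pred (hne₁ r) with he₁'_def
        set e₂' : Fin q → Fin (n + 2) := fun r => (e₂ r).pred (hne r) with he₂'_def
        have he₁'s : ∀ r, e₁ r.succ = (e₁' r).succ := fun r => (Fin.succ_pred _ (hne₁ r)).symm
        have he₂'s : ∀ r, e₂ r = (e₂' r).succ := fun r => (Fin.succ_pred _ (hne r)).symm
        have he₁' : StrictMono e₁' := by
          intro a b hab
          have h := he₁ (Fin.succ_lt_succ_iff.2 hab)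
          rw [he₁'s a, he₁'s b] at h
          exact Fin.succ_lt_succ_iff.1 h
        have he₂' : StrictMono e₂' := by
          intro a b hab
          have h := he₂ hab
          rw [he₂'s a, he₂'s b] at h
          exact Fin.succ_lt_succ_iff.1 h
        have hdisj' : ∀ r r', e₁' r ≠ e₂' r' := by
          intro r r' h
          exact hdisj r.succ r' (by rw [he₁'s, he₂'s, h])
        have hcover' : ∀ i : Fin (n + 2), (∃ r, e₁' r = i) ∨ (∃ r, e₂' r = i) := by
          intro i
          rcases hcover i.succ with ⟨r, hr⟩ | ⟨r, hr⟩
          · left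
            have hr0 : r ≠ 0 := by rintro rfl; rw [h0] at hr; exact (Fin.succ_ne_zero i) hr.symm
            obtain ⟨r', rfl⟩ := Fin.exists_succ_eq.2 hr0
            exact ⟨r', Fin.succ_injective _ (by rw [← he₁'s, hr])⟩
          · right
            exact ⟨r, Fin.succ_injective _ (by rw [← he₂'s, hr])⟩
        refine sahiE_eq_neg_mul_of_cross_moments_step w H e₁ e₂ e₁' e₂' h0 he₁'s he₂'s he₁'.injective hdisj'
          hcover' hcross fun G hG => ?_
        -- induction hypothesis for the tail family `G`, head slot in group 1 or in group 2
        rcases hcover' 0 with ⟨r, hr⟩ | ⟨r, hr⟩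
        · have hr0 : e₁' 0 = 0 := by
            have : r = 0 := by
              by_contra hne'
              have hlt : e₁' 0 < e₁' r := he₁' (Fin.pos_of_ne_zero hne')
              rw [hr] at hlt
              exact (Fin.not_lt_zero _ hlt).elim
            rw [← this, hr]
          exact ih p' q G e₁' e₂' he₁' he₂' hr0 hq hdisj' hcover' hG
        · obtain ⟨q', rfl⟩ : ∃ q', q = q' + 1 := Nat.exists_eq_add_one.2 hq
          have hr0 : e₂' 0 = 0 := by
            have : r = 0 := by
              by_contra hne'
              have hlt : e₂' 0 < e₂' r := he₂' (Fin.pos_of_ne_zero hne')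
              rw [hr] at hlt
              exact (Fin.not_lt_zero _ hlt).elim
            rw [← this, hr]
          rw [ih q' (p' + 1) G e₂' e₁' he₂' he₁' hr0 (Nat.succ_pos _) (fun r r' h => hdisj' r' r h.symm)
            (fun i => (hcover' i).symm) (fun T h2 h1 => hG T h1 h2), mul_comm]
  -- general case: the head slot lies in one of the two groups
  intro n p q H e₁ e₂ he₁ he₂ hp hq hdisj hcover hcross
  rcases hcover 0 with ⟨r, hr⟩ | ⟨r, hr⟩
  · obtain ⟨p', rfl⟩ : ∃ p', p = p' + 1 := Nat.exists_eq_add_one.2 hp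
    have hr0 : e₁ 0 = 0 := by
      have : r = 0 := by
        by_contra hne'
        have hlt : e₁ 0 < e₁ r := he₁ (Fin.pos_of_ne_zero hne')
        rw [hr] at hlt
        exact (Fin.not_lt_zero _ hlt).elim
      rw [← this, hr]
    exact main n p' q H e₁ e₂ he₁ he₂ hr0 hq hdisj hcover hcross
  · obtain ⟨q', rfl⟩ : ∃ q', q = q' + 1 := Nat.exists_eq_add_one.2 hq
    have hr0 : e₂ 0 = 0 := by
      have : r = 0 := by
        by_contra hne'
        have hlt : e₂ 0 < e₂ r := he₂ (Fin.pos_of_ne_zero hne')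
        rw [hr] at hlt
        exact (Fin.not_lt_zero _ hlt).elim
      rw [← this, hr]
    rw [main n q' p H e₂ e₁ he₂ he₁ hr0 hp (fun r r' h => hdisj r' r h.symm) (fun i => (hcover i).symm)
      (fun T h2 h1 => hcross T h1 h2), mul_comm]

end

end Summit.CriticalPhenomena.PercolationContinuityZ3.Theorems.SahiTangent
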